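import Literature.NumberTheory.NumberFields.ClassGroupNormRelations
import Literature.NumberTheory.NumberFields.KummerPlusMinusRankOne
import Literature.NumberTheory.NumberFields.CMFieldClassGroupPlusMinusDecomposition
import Literature.NumberTheory.NumberFields.CMFieldClassGroupNormConj
import Mathlib.NumberTheory.NumberField.CMField
import Literature.GroupTheory.FiniteAbelian.OddIsotypicComponentsMinusPart
import HarnessLib

set_option autoImplicit false

/-!
# The minus `p`-torsion of the class group of an abelian CM field is carried by its ODD CYCLIC subfields:
# `#Cl(K)[p] ≤ p · (∏_{χ odd} #Cl(K^{ker χ})[p])²` — Leopoldt–Scholz reflection, isotypic form (theorem-only;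
# no named fact, no `sorry`)

Topic `NumberTheory/NumberFields` (namespace = path).  THEOREM-ONLY file written by the prover seat `bsd-potss-rkm`
(generation 37, cell `bsd-potss`; `--supports` stmt-BirchSwinnertonDyer-19196, crux M `ReducibleKatoMember` of the routes K9
`KatoDescentPotSupersingular` / K8-t′ `KatoDescentTamePotSupersingular`; closes nothing).  It generalises the one-field
inequality of `IwasawaTheory/ClassicalMuVanishesReflectionLayer.lean` (generation 36: the biquadratic configuration
`Gal ⊇ ⟨z, b⟩`, `|⟨z,b⟩| = 4`) to an ARBITRARY finite commutative group `G` of exponent dividing `p - 1` acting on a CM field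
`K ∋ ζ_p` through `s : G → Gal(K/F)` with `K^{⟨s z⟩}` totally real.  The companion file
`IwasawaTheory/ClassicalMuVanishesOddCharacterDescent.lean` pushes it up the cyclotomic `ℤ_p`-tower and descends `μ = 0`.

## The mathematics (all inputs are tree theorems or Mathlib)

Let `p` be an odd prime, `G` a finite commutative group with `exp G ∣ p − 1` (so every character of `G` is `𝔽_p`-valued:
`Ĝ = Hom(G, 𝔽_pˣ)` has `#Ĝ = #G` and separates points — Mathlib `CommGroup.exists_apply_ne_one_of_hasEnoughRootsOfUnity`,
`CommGroup.card_monoidHom_of_hasEnoughRootsOfUnity`, `ZMod p` having enough `(p−1)`-th roots of unity), acting on a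
commutative group `A` (`ρ : G → Aut A`), and `N ≤ A` a `G`-stable subgroup of exponent `p` on which a fixed `z ∈ G` acts by
INVERSION.  §1 (group algebra, `𝔽_p[G] = ∏_χ 𝔽_p e_χ`): the twisted traces `T_χ(m) = ∏_g (g·m)^{χ(g)⁻¹}` satisfy
`h·T_χ(m) = T_χ(m)^{χ(h)}` (so `T_χ(m) ∈ N^{ker χ}`), `∏_χ T_χ(m) = m^{#G}` (orthogonality `∑_χ χ(g) = #G·[g = 1]` in `𝔽_p`),
and `T_χ(m) = 1` for EVEN `χ` (`χ(z) = 1`: `z` fixes and inverts `T_χ(m)`, `p` odd); as `m ↦ m^{#G}` is onto `N` (`p ∤ #G`):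
  **`N = ∏_{χ(z) ≠ 1} T_χ(N)`, hence `#N ≤ ∏_{χ odd} #N^{ker χ}`** (`card_le_prod_card_fixed_of_oddCharacters`).
§2 (number fields): for `K/F` finite Galois and `H ≤ Gal(K/F)` with `p ∤ #H`, the norm `N_{K/K^H}` is injective on the
`H`-fixed `p`-torsion classes (`i ∘ N = ∏_{h ∈ H} h = (·)^{#H}` there, tree `classGroupExtend_classGroupNorm_fixedField_eq_prod`),
so `#Cl(K)[p]^H ≤ #Cl(K^H)[p]` (`natCard_fixed_torsion_classGroup_le`).  §3: if `K` is totally complex, `ζ_p ∈ K`, and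
`K^{⟨s z⟩}` is totally real for an involution `z ∈ G` with `s z ≠ 1`, then `K` is CM with complex conjugation `s z`
(`complexConj_apply_eq_of_isTotallyReal_fixedField`), the minus `p`-torsion `Cl(K)[p] ∩ ker N_{K/K⁺}` is `G`-stable and
inverted by `z` (tree `IsCMField.conj_smul_eq_inv_iff_classGroupNorm_eq_one_of_pow_eq_one`), and Lang's Thm. 2.1 (i)
`#Cl(K⁺)[p] ≤ p·#Cl(K)⁻[p]` (tree `IsCMField.card_pTorsion_classGroup_maximalRealSubfield_le_mul`) with the `±`
decomposition `#Cl(K)[p] = #Cl(K⁺)[p]·#Cl(K)⁻[p]` (tree `IsCMField.card_pTorsion_classGroup`) give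
  **`#Cl(K)[p] ≤ p · (∏_{χ ∈ Ĝ, χ(z) ≠ 1} #Cl(K^{s(ker χ)})[p])²`**, i.e.
  **`rank_p Cl(K) ≤ 1 + 2·∑_{χ odd} rank_p Cl(K^{s(ker χ)})`** (`natCard_torsion_classGroup_le_of_oddCharacters`).
The fields `K^{s(ker χ)}`, `χ` odd, are (when `s` is onto) exactly the subfields `M ⊆ K` with `Gal(M/F)` CYCLIC that are not
fixed by `z` — for `F = ℚ`: the IMAGINARY CYCLIC subfields of the abelian CM field `K`.  This is the reflection principle
`rank_p A(χ_even) ≤ δ + rank_p A(ωχ_even⁻¹)` (Leopoldt's Spiegelungssatz) in the coarse `±` form that Lang's theorem gives,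
combined with the isotypic descent of the minus part; no Kummer generators are handled here.

## Main results

* `sum_monoidHom_apply_eq_zero`, `card_monoidHom_eq_natCard` — orthogonality and `#Ĝ = #G` for `𝔽_pˣ`-valued characters of
  a finite commutative group of exponent dividing `p − 1` (from Mathlib's duality for finite abelian groups).
* `card_le_prod_card_fixed_of_oddCharacters` — §1.
* `natCard_fixed_torsion_classGroup_le` — §2.
* `complexConj_apply_eq_of_isTotallyReal_fixedField`, `mulEquiv_intAut_complexConj_eq` — §3, the complex conjugation of
  the CM structure `K/K^{⟨σ⟩}` is `σ`.
* `natCard_torsion_classGroup_le_of_oddCharacters` — THE INEQUALITY.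

## What is NOT here (honest scope)

No `p`-adic `L`-function and no `μ⁻ = 0`; no component-wise (character-by-character) Spiegelungssatz with units
(`-- TODO(general form): rank_p A^{χ} ≤ rank_p A^{ωχ⁻¹} + δ_χ for each even χ [Washington1997, Thm. 10.11]` — only the
`±`-summed form is proved); nothing about `ℤ_p`-towers (companion file) or elliptic curves.  BSD is advanced for no curve.

## References

* S. Lang, *Cyclotomic Fields I and II*, GTM 121 (1990), Ch. 13 §2, Thm. 2.1 (i) (pp. 199–200); Ch. 3 §4. [Lang1990]
* L. C. Washington, *Introduction to Cyclotomic Fields*, 2nd ed., GTM 83 (1997): §10.2 (Thm. 10.10 Scholz, Thm. 10.11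
  Leopoldt's Spiegelungssatz), §6.3 (idempotents `ε_χ` of `ℤ_p[G]`, `p ∤ #G`), §7.5 (the reduction of `μ = 0` for abelian
  fields to odd characters). [Washington1997]
* J.-F. Biasse, C. Fieker, T. Hofmann, A. Page, J. London Math. Soc. 105 (2022), Prop. 3.7 (norm/extension on class groups of
  fixed fields). [BiasseEtAl2022]
* J. Neukirch, *Algebraic Number Theory* (1999), Ch. III §1 Prop. (1.6) (iv). [NeukirchANT1999]
* Tree: `NumberFields/ClassGroupNormRelations.lean`, `NumberFields/KummerPlusMinusRankOne.lean`,
  `NumberFields/CMFieldClassGroupPlusMinusDecomposition.lean`, `NumberFields/CMFieldClassGroupNormConj.lean`;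
  Mathlib `GroupTheory/FiniteAbelian/Duality`, `RingTheory/ZMod/Torsion`, `NumberTheory/NumberField/CMField`.
-/

noncomputable section

open scoped NumberField
open Field IntermediateField NumberField NumberField.InfinitePlace
open Literature.GroupTheory.FiniteAbelian

namespace Literature.NumberTheory.NumberFields


/-! ### §2 Number fields: `H`-fixed `p`-torsion classes descend to `K^H` when `p ∤ #H` -/

section DescentCount

variable (F K : Type) [Field F] [NumberField F] [Field K] [NumberField K] [Algebra F K] [IsGalois F K]

/-- **`H`-fixed `p`-torsion classes descend: `#Cl(K)[p]^H ≤ #Cl(K^H)[p]` when `p ∤ #H`.**  For `K/F` finite Galois and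
`H ≤ Gal(K/F)`, the norm `N_{K/K^H}` is injective on the `H`-fixed classes killed by `p`: `i(N c) = ∏_{h ∈ H} h·c = c^{#H}`
(Neukirch III (1.6) (iv), tree `classGroupExtend_classGroupNorm_fixedField_eq_prod`) and `c ↦ c^{#H}` is injective on the
`p`-torsion (`gcd(#H, p) = 1`). [cite: NeukirchANT1999, Ch. III §1 Prop. (1.6) (iv)] [cite: Washington1997, §10.1] -/
theorem natCard_fixed_torsion_classGroup_le (H : Subgroup (K ≃ₐ[F] K)) [Fintype H] {p : ℕ} (hp : p.Prime)
    (hpH : ¬ p ∣ Fintype.card H) :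
    Nat.card {c : ClassGroup (𝓞 K) // c ^ p = 1 ∧ ∀ h ∈ H, ClassGroup.mulEquiv (AmbiguousClass.intAut h) c = c} ≤
      Nat.card {d : ClassGroup (𝓞 ↥(fixedField H)) // d ^ p = 1} := by
  classical
  haveI : FiniteDimensional F K := Module.Finite.of_restrictScalars_finite ℚ F K
  let Φ : {c : ClassGroup (𝓞 K) // c ^ p = 1 ∧ ∀ h ∈ H, ClassGroup.mulEquiv (AmbiguousClass.intAut h) c = c} →
      {d : ClassGroup (𝓞 ↥(fixedField H)) // d ^ p = 1} := fun c =>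
    ⟨classGroupNorm ↥(fixedField H) K c.1, by rw [← map_pow, c.2.1, map_one]⟩
  have key : ∀ c : ClassGroup (𝓞 K), (∀ h ∈ H, ClassGroup.mulEquiv (AmbiguousClass.intAut h) c = c) →
      classGroupExtend ↥(fixedField H) K (classGroupNorm ↥(fixedField H) K c) = c ^ Fintype.card H := by
    intro c hc
    rw [NormRelation.classGroupExtend_classGroupNorm_fixedField_eq_prod F K H c,
      Finset.prod_congr rfl fun (h : ↥H) _ => hc h.1 h.2, Finset.prod_const, Finset.card_univ]
  have hg : Nat.gcd (Fintype.card H) p = 1 :=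
    Nat.Coprime.gcd_eq_one (Nat.coprime_comm.mp ((Nat.Prime.coprime_iff_not_dvd hp).mpr hpH))
  have hΦ : Function.Injective Φ := by
    rintro ⟨c, hc, hcfix⟩ ⟨c', hc', hc'fix⟩ h
    apply Subtype.ext
    have h1 : classGroupNorm ↥(fixedField H) K c = classGroupNorm ↥(fixedField H) K c' := congrArg Subtype.val h
    have h2 : (c / c') ^ Fintype.card H = 1 := by
      rw [div_pow, ← key c hcfix, ← key c' hc'fix, h1, div_self']
    have h3 : (c / c') ^ p = 1 := by rw [div_pow, hc, hc', div_one]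
    have h4 : (c / c') ^ 1 = 1 := by
      rw [← hg]
      exact pow_gcd_eq_one.mpr ⟨h2, h3⟩
    rw [pow_one] at h4
    exact div_eq_one.mp h4
  exact Nat.card_le_card_of_injective Φ hΦ

end DescentCount


section ComplexConj

open NumberField.IsCMField

variable {F K : Type} [Field F] [NumberField F] [Field K] [NumberField K] [Algebra F K] [IsGalois F K]

omit [IsGalois F K] in
/-- **The complex conjugation of a CM field is THE involution with totally real fixed field.**  If `K` is CM (Mathlib
`IsCMField`, complex conjugation `complexConj K ∈ Gal(K/K⁺)`) and `σ ∈ Gal(K/F)` is an involution `≠ 1` whose fixed field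
`K^{⟨σ⟩}` is totally real, then `complexConj K = σ` pointwise: `K^{⟨σ⟩} ⊆ K⁺` (Mathlib `IsTotallyReal.le_maximalRealSubfield`), so
`complexConj K` fixes `K^{⟨σ⟩}` and lies in `⟨σ⟩ = {1, σ}` (`fixingSubgroup_fixedField`), and it is `≠ 1`.
[cite: Washington1997, Ch. 4 (CM fields: complex conjugation is an automorphism independent of the embedding, before Thm. 4.12)]
[cite: Lang1990, Ch. 3 §4 (complex conjugation `τ` of a CM field)] -/
theorem complexConj_apply_eq_of_isTotallyReal_fixedField [IsCMField K] (σ : K ≃ₐ[F] K) (hσ1 : σ ≠ 1) (hσ : σ * σ = 1)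
    (hreal : IsTotallyReal ↥(fixedField (Subgroup.zpowers σ))) (x : K) :
    complexConj K x = σ x := by
  haveI : FiniteDimensional F K := Module.Finite.of_restrictScalars_finite ℚ F K
  set F₀ : IntermediateField F K := fixedField (Subgroup.zpowers σ) with hF₀
  -- `F₀ ⊆ K⁺`
  haveI : IsTotallyReal ↥F₀.toSubfield := IsTotallyReal.ofRingEquiv (RingEquiv.refl ↥F₀)
  have hle : F₀.toSubfield ≤ maximalRealSubfield K := IsTotallyReal.le_maximalRealSubfield F₀.toSubfield
  have hfix : ∀ y ∈ F₀, complexConj K y = y := fun y hy =>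
    (complexConj_eq_self_iff K y).mpr (hle (show y ∈ F₀.toSubfield from hy))
  -- `complexConj` as an `F`-automorphism
  let τ : K ≃ₐ[F] K :=
    { (complexConj K : K ≃+* K) with
      commutes' := fun a => hfix _ (F₀.algebraMap_mem a) }
  have hτ : ∀ y, τ y = complexConj K y := fun _ => rfl
  have hτmem : τ ∈ Subgroup.zpowers σ := by
    rw [← fixingSubgroup_fixedField (Subgroup.zpowers σ), IntermediateField.mem_fixingSubgroup_iff]
    intro y hy
    rw [hτ]
    exact hfix y hy
  have hτ1 : τ ≠ 1 := by
    intro h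
    apply complexConj_ne_one K
    ext y
    have := congrArg (fun f : K ≃ₐ[F] K => f y) h
    simp only [hτ, AlgEquiv.one_apply] at this
    rw [AlgEquiv.one_apply]
    exact this
  -- `zpowers σ = {1, σ}`
  have horder : orderOf σ = 2 := orderOf_eq_prime (by rw [pow_two, hσ]) hσ1
  have hcard : Nat.card ↥(Subgroup.zpowers σ) = 2 := by rw [Nat.card_zpowers, horder]
  rw [Nat.card_eq_two_iff' (⟨1, one_mem _⟩ : ↥(Subgroup.zpowers σ))] at hcard
  obtain ⟨y, -, hy⟩ := hcard
  have h1 : (⟨τ, hτmem⟩ : ↥(Subgroup.zpowers σ)) = y := hy _ (fun h => hτ1 (congrArg Subtype.val h))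
  have h2 : (⟨σ, Subgroup.mem_zpowers σ⟩ : ↥(Subgroup.zpowers σ)) = y :=
    hy _ (fun h => hσ1 (congrArg Subtype.val h))
  have h3 : τ = σ := congrArg Subtype.val (h1.trans h2.symm)
  rw [← hτ, h3]

omit [IsGalois F K] in
/-- Hence the Galois action of `complexConj K` on `Cl(K)` is that of `σ` (same ring automorphism of `𝓞 K`).
[cite: Lang1990, Ch. 3 §4 (action of `τ` on `C_K`)] -/
theorem mulEquiv_intAut_complexConj_eq [IsCMField K] (σ : K ≃ₐ[F] K) (hσ1 : σ ≠ 1) (hσ : σ * σ = 1)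
    (hreal : IsTotallyReal ↥(fixedField (Subgroup.zpowers σ))) :
    ClassGroup.mulEquiv (AmbiguousClass.intAut (complexConj K)) =
      ClassGroup.mulEquiv (AmbiguousClass.intAut σ) := by
  have h : (complexConj K).toRingEquiv = σ.toRingEquiv :=
    RingEquiv.ext fun x => complexConj_apply_eq_of_isTotallyReal_fixedField σ hσ1 hσ hreal x
  change ClassGroup.mulEquiv (RingOfIntegers.mapRingEquiv (complexConj K).toRingEquiv) =
    ClassGroup.mulEquiv (RingOfIntegers.mapRingEquiv σ.toRingEquiv)
  rw [h]

end ComplexConj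


section ThmB

open NumberField.IsCMField

variable {G : Type} [CommGroup G] [Fintype G] {p : ℕ} [hp : Fact p.Prime]

/-- `p ∤ #H` for a finite group killed by `p - 1` (Cauchy). [folklore] -/
private theorem not_dvd_card_of_forall_pow_eq_one {H : Type*} [Group H] [Fintype H] (h : ∀ x : H, x ^ (p - 1) = 1) :
    ¬ p ∣ Fintype.card H := by
  intro hd
  obtain ⟨g, hg⟩ := exists_prime_orderOf_dvd_card p hd
  have h1 : orderOf g ∣ p - 1 := orderOf_dvd_of_pow_eq_one (h g)
  rw [hg] at h1
  have h2 := Nat.le_of_dvd (Nat.sub_pos_of_lt hp.out.one_lt) h1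
  have h3 := hp.out.one_lt
  omega

variable (F K : Type) [Field F] [NumberField F] [Field K] [NumberField K] [Algebra F K] [IsGalois F K]

/-- **THE MINUS `p`-TORSION OF AN ABELIAN CM CLASS GROUP IS CARRIED BY THE ODD CYCLIC SUBFIELDS (Leopoldt–Scholz reflection,
isotypic form).**  `K/F` finite Galois number fields, `K` totally complex containing a primitive `p`-th root of unity (`p` an
odd prime), `G` a finite commutative group with `exp G ∣ p − 1` acting through `s : G → Gal(K/F)`, `z ∈ G` an involution with
`s z ≠ 1` and `K^{⟨s z⟩}` totally real (so `K` is CM with complex conjugation `s z`).  Then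
  **`#Cl(K)[p] ≤ p · (∏_{χ : G → 𝔽_pˣ, χ(z) ≠ 1} #Cl(K^{s(ker χ)})[p])²`**,
i.e. `rank_p Cl(K) ≤ 1 + 2·∑_{χ odd} rank_p Cl(K^{s(ker χ)})`.  Proof: `#Cl(K)[p] = #Cl(K⁺)[p]·#Cl(K)⁻[p]` and Lang's
Thm. 2.1 (i) `#Cl(K⁺)[p] ≤ p·#Cl(K)⁻[p]` (tree, on the tree's Hilbert class field) give `#Cl(K)[p] ≤ p·(#Cl(K)⁻[p])²`; the minus
`p`-torsion `Cl(K)⁻[p] = Cl(K)[p] ∩ ker N_{K/K⁺}` is `G`-stable and inverted by `z`, so by the odd-isotypic decomposition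
(`Literature.GroupTheory.FiniteAbelian.card_le_prod_card_fixed_of_oddCharacters`) `#Cl(K)⁻[p] ≤ ∏_{χ odd} #Cl(K)[p]^{s(ker χ)}`,
and each factor descends to `K^{s(ker χ)}` (`natCard_fixed_torsion_classGroup_le`, `p ∤ #s(ker χ)`).  For `G = Gal(K/ℚ)` the
fields `K^{ker χ}`, `χ` odd, are the IMAGINARY CYCLIC subfields of `K`; for `G = ⟨z, b⟩` of order `4` this is generation 36's
`natCard_torsion_classGroup_fixedField_reflection_le` up to the Kuroda factor.
[cite: Lang1990, Ch. 13 §2, Thm. 2.1 (i) (pp. 199–200)] [cite: Washington1997, §10.2 (Thm. 10.10 Scholz, Thm. 10.11 Leopoldt's Spiegelungssatz), §6.3]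
[cite: NeukirchANT1999, Ch. III §1 Prop. (1.6) (iv)] -/
theorem natCard_torsion_classGroup_le_of_oddCharacters [IsTotallyComplex K] [Fintype (G →* (ZMod p)ˣ)]
    (hp2 : p ≠ 2) {ζ : K} (hζ : IsPrimitiveRoot ζ p) (hG : Monoid.exponent G ∣ p - 1)
    (s : G →* (K ≃ₐ[F] K)) {z : G} (hz : z * z = 1) (hz1 : s z ≠ 1)
    (hreal : IsTotallyReal ↥(fixedField (Subgroup.zpowers (s z)))) :
    Nat.card {c : ClassGroup (𝓞 K) // c ^ p = 1} ≤
      p * (∏ χ : {χ : G →* (ZMod p)ˣ // χ z ≠ 1},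
        Nat.card {d : ClassGroup (𝓞 ↥(fixedField (((χ : G →* (ZMod p)ˣ).ker).map s))) // d ^ p = 1}) ^ 2 := by
  classical
  haveI : FiniteDimensional F K := Module.Finite.of_restrictScalars_finite ℚ F K
  -- the CM structure `K⁺ = K^{⟨s z⟩}`
  set F₀ : IntermediateField F K := fixedField (Subgroup.zpowers (s z)) with hF₀
  haveI : IsTotallyReal ↥F₀ := hreal
  have hsz : s z * s z = 1 := by rw [← map_mul, hz, map_one]
  have horder : orderOf (s z) = 2 := orderOf_eq_prime (by rw [pow_two, hsz]) hz1
  haveI : Algebra.IsQuadraticExtension ↥F₀ K :=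
    { toFree := Module.Free.of_divisionRing ↥F₀ K
      finrank_eq_two' := by rw [hF₀, finrank_fixedField_eq_card, Nat.card_zpowers, horder] }
  haveI : IsCMField K := IsCMField.ofCMExtension ↥F₀ K
  have hconj := mulEquiv_intAut_complexConj_eq (s z) hz1 hsz hreal
  -- the Galois action of `G` on `Cl(K)` through `s`
  let ρK : (K ≃ₐ[F] K) →* MulAut (ClassGroup (𝓞 K)) :=
    { toFun := fun σ => ClassGroup.mulEquiv (AmbiguousClass.intAut σ)
      map_one' := AmbiguousClass.mulEquiv_intAut_one
      map_mul' := fun σ τ => AmbiguousClass.mulEquiv_intAut_mul σ τ }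
  let ρ : G →* MulAut (ClassGroup (𝓞 K)) := ρK.comp s
  have hρ : ∀ g c, ρ g c = ClassGroup.mulEquiv (AmbiguousClass.intAut (s g)) c := fun _ _ => rfl
  have hρz : ∀ c, ρ z c = ClassGroup.mulEquiv (AmbiguousClass.intAut (complexConj K)) c := fun c => by
    rw [hρ, hconj]
  -- the minus `p`-torsion
  set N : Subgroup (ClassGroup (𝓞 K)) := (powMonoidHom p : ClassGroup (𝓞 K) →* ClassGroup (𝓞 K)).ker ⊓
    (classGroupNorm ↥(maximalRealSubfield K) K).ker with hN
  have hNp : ∀ m ∈ N, m ^ p = 1 := fun m hm => (Subgroup.mem_inf.mp hm).1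
  have hNz : ∀ m ∈ N, ρ z m = m⁻¹ := fun m hm => by
    rw [hρz]
    exact IsCMField.conj_smul_eq_inv_of_classGroupNorm_eq_one K (Subgroup.mem_inf.mp hm).2
  have hNst : ∀ g, ∀ m ∈ N, ρ g m ∈ N := by
    intro g m hm
    have h1 : (ρ g m) ^ p = 1 := by rw [← map_pow, hNp m hm, map_one]
    refine Subgroup.mem_inf.mpr ⟨h1, ?_⟩
    refine (IsCMField.conj_smul_eq_inv_iff_classGroupNorm_eq_one_of_pow_eq_one K hp.out hp2 (k := 1)
      (c := ρ g m) (by rw [pow_one, h1])).mp ?_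
    rw [← hρz, ← MulAut.mul_apply, ← map_mul, mul_comm, map_mul, MulAut.mul_apply, hNz m hm, map_inv]
  -- Theorem A on `N`
  have hA := card_le_prod_card_fixed_of_oddCharacters (A := ClassGroup (𝓞 K)) hp2 hG ρ N hNst hNp hNz
  -- each factor: fixed vectors descend to `K^{s(ker χ)}`
  have hfac : ∀ χ : {χ : G →* (ZMod p)ˣ // χ z ≠ 1},
      Nat.card {m : ClassGroup (𝓞 K) // m ∈ N ∧ ∀ g ∈ (χ : G →* (ZMod p)ˣ).ker, ρ g m = m} ≤
        Nat.card {d : ClassGroup (𝓞 ↥(fixedField (((χ : G →* (ZMod p)ˣ).ker).map s))) // d ^ p = 1} := by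
    intro χ
    set H : Subgroup (K ≃ₐ[F] K) := ((χ : G →* (ZMod p)ˣ).ker).map s with hH
    have hpH : ¬ p ∣ Fintype.card ↥H := by
      refine not_dvd_card_of_forall_pow_eq_one fun x => Subtype.ext ?_
      obtain ⟨g, -, hg⟩ := Subgroup.mem_map.mp x.2
      rw [Subgroup.coe_pow, ← hg, ← map_pow, Subgroup.coe_one]
      obtain ⟨k, hk⟩ := hG
      rw [hk, pow_mul, Monoid.pow_exponent_eq_one, one_pow, map_one]
    refine le_trans ?_ (natCard_fixed_torsion_classGroup_le F K H hp.out hpH)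
    refine Nat.card_le_card_of_injective (fun m => ⟨m.1, hNp _ m.2.1, fun h hh => ?_⟩) fun m m' hmm' => by
      apply Subtype.ext
      simpa only [Subtype.mk.injEq] using congrArg Subtype.val hmm'
    obtain ⟨g, hg, rfl⟩ := Subgroup.mem_map.mp hh
    rw [← hρ]
    exact m.2.2 g hg
  have hB : Nat.card N ≤ ∏ χ : {χ : G →* (ZMod p)ˣ // χ z ≠ 1},
      Nat.card {d : ClassGroup (𝓞 ↥(fixedField (((χ : G →* (ZMod p)ˣ).ker).map s))) // d ^ p = 1} :=
    hA.trans (Finset.prod_le_prod' fun χ _ => hfac χ)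
  -- Lang's Thm. 2.1 (i) and the `±` decomposition
  have hLang := IsCMField.card_pTorsion_classGroup_maximalRealSubfield_le_mul K hp.out hp2 hζ
  have hpm := IsCMField.card_pTorsion_classGroup K hp.out hp2
  have hT : Nat.card {c : ClassGroup (𝓞 K) // c ^ p = 1} =
      Nat.card (powMonoidHom p : ClassGroup (𝓞 K) →* ClassGroup (𝓞 K)).ker :=
    Nat.card_congr (Equiv.subtypeEquivRight fun m => by rw [MonoidHom.mem_ker, powMonoidHom_apply])
  rw [hT, hpm]
  calc _ ≤ p * Nat.card N * Nat.card N := Nat.mul_le_mul_right _ hLang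
    _ = p * Nat.card N ^ 2 := by ring
    _ ≤ _ := Nat.mul_le_mul_left _ (Nat.pow_le_pow_left hB 2)

end ThmB

end Literature.NumberTheory.NumberFields

end
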